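import Mathlib.NumberTheory.Zsqrtd.Basic
import Mathlib.Data.ZMod.Basic
import Mathlib.RingTheory.PrincipalIdealDomain
import Mathlib.Tactic.LinearCombination
import Literature.Algebra.EuclideanDomain.TransfiniteSmallestAlgorithm
import Literature.Algebra.EuclideanDomain.NormalisedEuclideanAlgorithm
import HarnessLib

/-!
# `ℤ[√10]`: not principal, hence Euclidean for no (transfinite) algorithm — yet its transfinite construction does not
# stop with the units (Samuel 1971, §5 Remark (2))

Topic `Literature/NumberTheory/QuadraticFields`, namespace `Literature.NumberTheory.QuadraticFields.ZSqrtTen`.  THEOREMS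
ONLY (no `def`, no instance, no named fact), all proved, in the vocabulary of
`Literature/Algebra/EuclideanDomain/TransfiniteSmallestAlgorithm.lean` (Samuel's stages `samuelSet`, smallest algorithm
`samuelRank = θ`) and `UniversalSideDivisors.lean` (`IsUniversalSideDivisor` = Samuel's `A₂ − A₁`).

## Source (read at the page)

P. Samuel, *About Euclidean rings*, J. Algebra **19** (1971) 282–301 [Samuel1971] (materialised
`paper:doi-10-1016-0021-8693-71-90110-4`, §5 p. 294), VERBATIM: «Remarks. … (2) One should not conclude from the proof
of Prop. 14 that, if a ring `A` is not Euclidean, its transfinite construction stops with the units.  In fact, in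
`A = ℤ[√10]`, the elements `3 + 2√10` and `9 + 2√10` generate prime ideals `pᵢ` (`i = 1, 2`), of norms 31 and 41, for
which the class of the fundamental unit `3 + √10` of `A` generates the multiplicative group `(A/pᵢ)*` (i.e. `3 + √10` is
a primitive root mod `pᵢ`).  Thus the nonzero cosets mod `pᵢ` are represented by units, and the elements `3 + 2√10`,
`9 + 2√10` (and their associates) belong to the stage `A₂` of the transfinite construction of `A`.  However `ℤ[√10]` is
surely not Euclidean, since it is not even principal (its class number is 2).»

## What is formalised (for `p₁ = (3 + 2√10)`; the second prime `9 + 2√10` is left aside)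

* §1 `dvd_iff`: `3 + 2√10 ∣ y ⟺ 31 ∣ y.re + 14·y.im` (`√10 ≡ 14 (mod p₁)`: `3 + 2·14 = 31`, `14² = 196 ≡ 10`), with the
  explicit quotient; the residue `y ↦ y.re + 14 y.im (mod 31)` is multiplicative (`residue_mul`).
* §2 the fundamental unit `u = 3 + √10` (`u(−3 + √10) = 1`), `residue (uᵏ) = 17ᵏ (mod 31)` and «`3 + √10` is a
  primitive root mod `p₁`»: every non-zero class mod 31 is a power of `17` (`decide`).
* §3 **`isUniversalSideDivisor`**: every class mod `3 + 2√10` contains `0` or a unit (a power `uᵏ`), i.e.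
  `3 + 2√10 ∈ A₂ − A₁`; in Samuel's `θ`: **`samuelRank_eq_two`** (`θ(3 + 2√10) = 2`) and `samuelSet_one_ne_samuelSet_two`
  (the construction does NOT stop with the units).
* §4 **`not_isPrincipalIdealRing`** («not even principal»: the ideal `(2, √10)` is proper, and a generator would have
  norm `±1` or `±2`, but `a² − 10b² = ±2` is impossible mod 5), hence `not_exists_algorithm` (no algorithm with values in
  any well-ordered set, by Samuel's Prop. 3 `Algorithm.isPrincipalIdealRing`) and `not_forall_exists_mem_samuelSet` (the
  transfinite construction does not exhaust `ℤ[√10]`).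
-- TODO(general form): the class number `2` itself and the second prime `9 + 2√10` (norm 41, `√10 ≡ 16`, `3 + √10 ↦ 19`,
-- a primitive root mod 41) are not formalised here.

## Mathlib / tree search

Mathlib: `Zsqrtd` (`re_mul`, `im_mul`, `norm_def`, `norm_mul`, `isUnit_iff_norm_isUnit`), `ZMod 31` with `decide`,
`ZMod.intCast_zmod_eq_zero_iff_dvd`, `Ideal.mem_span_pair`, `Int.isUnit_iff`.  Tree: `TransfiniteSmallestAlgorithm.lean`
(`samuelRank_eq_two_iff`, `samuelSet_one`, `samuelSet_two`, `samuelRank_isAlgorithm`),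
`NormalisedEuclideanAlgorithm.lean` (`Algorithm.isPrincipalIdealRing`), `UniversalSideDivisors.lean`; `rg "√10|Zsqrtd 10"`
in `Literature/NumberTheory/QuadraticFields` → only an L-value table, nothing on `ℤ[√10]` as a ring.
-/

namespace Literature.NumberTheory.QuadraticFields.ZSqrtTen

open Literature.Algebra.EuclideanDomain Zsqrtd

/-! ## §1 The prime `p₁ = (3 + 2√10)` of norm `−31`: `√10 ≡ 14 (mod p₁)` -/

/-- `N(3 + 2√10) = 9 − 40 = −31`. [cite: Samuel1971, §5 Remark (2) (p. 294)] -/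
theorem norm_three_add_two_sqrt : (⟨3, 2⟩ : ℤ√10).norm = -31 := by
  rw [norm_def]; norm_num

/-- **`3 + 2√10 ∣ y ⟺ 31 ∣ y.re + 14 y.im`** (`2·14 ≡ −3`, so `√10 ≡ 14 (mod p₁)`; the quotient is
`(2 y.im − 3k) + (2k − y.im)√10` when `y.re + 14 y.im = 31k`). [cite: Samuel1971, §5 Remark (2) (p. 294)] -/
theorem dvd_iff (y : ℤ√10) : (⟨3, 2⟩ : ℤ√10) ∣ y ↔ (31 : ℤ) ∣ y.re + 14 * y.im := by
  constructor
  · rintro ⟨q, hq⟩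
    rw [hq, re_mul, im_mul]
    exact ⟨q.re + 2 * q.im, by ring⟩
  · rintro ⟨k, hk⟩
    refine ⟨⟨2 * y.im - 3 * k, 2 * k - y.im⟩, Zsqrtd.ext ?_ ?_⟩
    · rw [re_mul]; linear_combination hk
    · rw [im_mul]; linear_combination (0 : ℤ) * hk

/-- The residue map `y ↦ y.re + 14 y.im (mod 31)` is multiplicative (`14² = 196 ≡ 10 (mod 31)`), i.e. it is the ring
homomorphism `ℤ[√10] → A/p₁ ≅ 𝔽₃₁`. [cite: Samuel1971, §5 Remark (2) (p. 294)] -/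
theorem residue_mul (x y : ℤ√10) :
    (((x * y).re + 14 * (x * y).im : ℤ) : ZMod 31) = ((x.re + 14 * x.im : ℤ) : ZMod 31) * (y.re + 14 * y.im : ℤ) := by
  have h : (14 : ZMod 31) * 14 = 10 := by decide
  rw [re_mul, im_mul]
  push_cast
  linear_combination (-((x.im : ZMod 31) * (y.im : ZMod 31))) * h

/-- In residues: `3 + 2√10 ∣ x − z` iff `x` and `z` have the same residue mod 31. [cite: Samuel1971, §5 Remark (2) (p. 294)] -/
theorem dvd_sub_iff_residue_eq (x z : ℤ√10) :
    (⟨3, 2⟩ : ℤ√10) ∣ x - z ↔ ((x.re + 14 * x.im : ℤ) : ZMod 31) = ((z.re + 14 * z.im : ℤ) : ZMod 31) := by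
  rw [dvd_iff, re_sub, im_sub, eq_comm, ← sub_eq_zero, ← Int.cast_sub,
    ZMod.intCast_zmod_eq_zero_iff_dvd]
  constructor <;> rintro ⟨k, hk⟩ <;> exact ⟨-k, by linear_combination (-1 : ℤ) * hk⟩

/-! ## §2 The fundamental unit `u = 3 + √10`, a primitive root mod `p₁` -/

/-- `(3 + √10)(−3 + √10) = 1`: the fundamental unit. [cite: Samuel1971, §5 Remark (2) (p. 294)] -/
theorem unit_mul_inv : (⟨3, 1⟩ : ℤ√10) * ⟨-3, 1⟩ = 1 := by decide

/-- `3 + √10` is a unit, and so are its powers. [cite: Samuel1971, §5 Remark (2) (p. 294)] -/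
theorem isUnit_pow (k : ℕ) : IsUnit ((⟨3, 1⟩ : ℤ√10) ^ k) :=
  (IsUnit.of_mul_eq_one _ unit_mul_inv).pow k

/-- The residue of `(3 + √10)ᵏ` is `17ᵏ (mod 31)` (`3 + 14 = 17`). [cite: Samuel1971, §5 Remark (2) (p. 294)] -/
theorem residue_pow (k : ℕ) :
    ((((⟨3, 1⟩ : ℤ√10) ^ k).re + 14 * ((⟨3, 1⟩ : ℤ√10) ^ k).im : ℤ) : ZMod 31) = 17 ^ k := by
  induction k with
  | zero => simp
  | succ k ih =>
    rw [pow_succ, residue_mul, ih, pow_succ]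
    congr 1

/-- **«`3 + √10` is a primitive root mod `p₁`»**: every non-zero residue mod `31` is a power `17ᵏ`, `k < 30`.
[cite: Samuel1971, §5 Remark (2) (p. 294)] -/
theorem exists_pow_seventeen_eq : ∀ t : ZMod 31, t ≠ 0 → ∃ k : ℕ, k < 30 ∧ (17 : ZMod 31) ^ k = t := by
  decide

/-! ## §3 `3 + 2√10` is a universal side divisor: it lies in the stage `A₂` -/

/-- **«the nonzero cosets mod `p₁` are represented by units»**: `3 + 2√10` is a universal side divisor of `ℤ[√10]`
(non-zero, not a unit — norm `−31` —, and every class mod it contains `0` or a power of `3 + √10`).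
[cite: Samuel1971, §5 Remark (2) (p. 294)] -/
theorem isUniversalSideDivisor : IsUniversalSideDivisor (⟨3, 2⟩ : ℤ√10) := by
  refine ⟨by decide, fun hu ↦ ?_, fun x ↦ ?_⟩
  · rw [isUnit_iff_norm_isUnit, norm_three_add_two_sqrt, Int.isUnit_iff] at hu
    rcases hu with h | h <;> exact absurd h (by norm_num)
  · by_cases h0 : ((x.re + 14 * x.im : ℤ) : ZMod 31) = 0
    · refine ⟨0, Or.inl rfl, ?_⟩
      rw [dvd_sub_iff_residue_eq, h0]
      simp
    · obtain ⟨k, -, hk⟩ := exists_pow_seventeen_eq _ h0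
      refine ⟨(⟨3, 1⟩ : ℤ√10) ^ k, Or.inr (isUnit_pow k), ?_⟩
      rw [dvd_sub_iff_residue_eq, residue_pow, hk]

/-- **«the elements `3 + 2√10` … belong to the stage `A₂` of the transfinite construction»**: `θ(3 + 2√10) = 2` for the
smallest algorithm `θ = samuelRank` (`A₂ − A₁` = universal side divisors). [cite: Samuel1971, §5 Remark (2) (p. 294)
and §4 (4.6) (p. 289)] -/
theorem samuelRank_eq_two : samuelRank (⟨3, 2⟩ : ℤ√10) = 2 :=
  samuelRank_eq_two_iff.2 isUniversalSideDivisor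

/-- `3 + 2√10 ∈ A₂ − A₁`: the transfinite construction of `ℤ[√10]` does NOT stop with the units («One should not
conclude … that, if a ring `A` is not Euclidean, its transfinite construction stops with the units»).
[cite: Samuel1971, §5 Remark (2) (p. 294)] -/
theorem mem_samuelSet_two_and_not_mem_one :
    (⟨3, 2⟩ : ℤ√10) ∈ samuelSet (ℤ√10) 2 ∧ (⟨3, 2⟩ : ℤ√10) ∉ samuelSet (ℤ√10) 1 :=
  mem_samuelSet_two_and_not_mem_one_iff.2 isUniversalSideDivisor

/-- Hence `A₁ ≠ A₂` for `ℤ[√10]`. [cite: Samuel1971, §5 Remark (2) (p. 294)] -/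
theorem samuelSet_one_ne_samuelSet_two : samuelSet (ℤ√10) 1 ≠ samuelSet (ℤ√10) 2 := fun h ↦
  mem_samuelSet_two_and_not_mem_one.2 (h ▸ mem_samuelSet_two_and_not_mem_one.1)

/-! ## §4 … although `ℤ[√10]` is not principal, hence not Euclidean for any algorithm -/

/-- No element of `ℤ[√10]` has norm `±2` (`a² − 10b² ≡ a² ≢ ±2 (mod 5)`). [cite: Samuel1971, §5 Remark (2) (p. 294)] -/
theorem norm_ne_two (z : ℤ√10) : z.norm ≠ 2 ∧ z.norm ≠ -2 := by
  rw [norm_def]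
  have key : ∀ a : ZMod 5, a * a ≠ 2 ∧ a * a ≠ -2 := by decide
  obtain ⟨h1, h2⟩ := key (z.re : ZMod 5)
  have h10 : (z.im : ZMod 5) * (z.im : ZMod 5) * 10 = 0 := by
    rw [show (10 : ZMod 5) = 0 by decide, mul_zero]
  constructor <;> intro h
  · apply h1
    have := congrArg (fun t : ℤ ↦ (t : ZMod 5)) h
    push_cast at this
    linear_combination this + h10
  · apply h2
    have := congrArg (fun t : ℤ ↦ (t : ZMod 5)) h
    push_cast at this
    linear_combination this + h10

/-- The ideal `(2, √10)` is proper: `1 ∉ (2, √10)` (real parts of its elements are even).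
[cite: Samuel1971, §5 Remark (2) (p. 294)] -/
theorem one_not_mem_span_two_sqrt : (1 : ℤ√10) ∉ Ideal.span ({2, ⟨0, 1⟩} : Set (ℤ√10)) := by
  intro h
  obtain ⟨p, q, hpq⟩ := Ideal.mem_span_pair.1 h
  have := congrArg Zsqrtd.re hpq
  rw [re_add, re_mul, re_mul, re_one] at this
  simp only [re_ofNat, im_ofNat] at this
  omega

/-- **«`ℤ[√10]` … is not even principal»**: the ideal `(2, √10)` is not principal — a generator would divide `2` and
`√10`, so its norm divides `4` and `10`, i.e. is `±1` (a unit: but the ideal is proper) or `±2` (impossible).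
[cite: Samuel1971, §5 Remark (2) (p. 294)] -/
theorem not_isPrincipalIdealRing : ¬IsPrincipalIdealRing (ℤ√10) := by
  intro hP
  obtain ⟨γ, hγ⟩ := (IsPrincipalIdealRing.principal (Ideal.span ({2, ⟨0, 1⟩} : Set (ℤ√10)))).principal
  have hγ' : Ideal.span ({2, ⟨0, 1⟩} : Set (ℤ√10)) = Ideal.span {γ} := by
    rw [hγ, Ideal.submodule_span_eq]
  have h2 : γ ∣ 2 := by
    rw [← Ideal.mem_span_singleton, ← hγ']; exact Ideal.subset_span (by simp)
  have h10 : γ ∣ (⟨0, 1⟩ : ℤ√10) := by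
    rw [← Ideal.mem_span_singleton, ← hγ']; exact Ideal.subset_span (by simp)
  -- `N(γ) ∣ 4` and `N(γ) ∣ −10`
  have hn4 : γ.norm ∣ 4 := by
    obtain ⟨q, hq⟩ := h2
    have := congrArg Zsqrtd.norm hq
    rw [norm_mul] at this
    exact ⟨q.norm, by rw [← this]; rw [norm_def]; norm_num⟩
  have hn10 : γ.norm ∣ 10 := by
    obtain ⟨q, hq⟩ := h10
    have := congrArg Zsqrtd.norm hq
    rw [norm_mul] at this
    have h' : (⟨0, 1⟩ : ℤ√10).norm = -10 := by rw [norm_def]; norm_num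
    rw [h'] at this
    exact ⟨-q.norm, by linear_combination -this⟩
  have hn2 : γ.norm ∣ 2 := by
    have := dvd_sub hn10 (dvd_mul_of_dvd_right hn4 2)
    norm_num at this
    exact this
  -- so `N(γ) ∈ {±1, ±2}`
  have habs : γ.norm.natAbs ∣ 2 := Int.natAbs_dvd_natAbs.2 hn2
  have hcases : γ.norm.natAbs = 1 ∨ γ.norm.natAbs = 2 := by
    have := (Nat.dvd_prime Nat.prime_two).1 habs
    exact this
  rcases hcases with h1 | h2'
  · -- `γ` is a unit: the ideal would be everything
    have hu : IsUnit γ := by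
      rw [isUnit_iff_norm_isUnit, Int.isUnit_iff_natAbs_eq]; exact h1
    apply one_not_mem_span_two_sqrt
    rw [hγ', Ideal.span_singleton_eq_top.2 hu]
    trivial
  · rcases Int.natAbs_eq γ.norm with h | h <;> rw [h2'] at h
    · exact (norm_ne_two γ).1 (by exact_mod_cast h)
    · exact (norm_ne_two γ).2 (by exact_mod_cast h)

/-- **«`ℤ[√10]` is surely not Euclidean»** — for NO algorithm, with values in any well-ordered set (Samuel's
Definition 1), since a ring with an algorithm is principal (Prop. 3). [cite: Samuel1971, §5 Remark (2) (p. 294) and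
Prop. 3 (p. 283)] -/
theorem not_exists_algorithm {W : Type*} [LinearOrder W] [WellFoundedLT W] :
    ¬∃ φ : ℤ√10 → W, ∀ a b : ℤ√10, b ≠ 0 → ∃ q r : ℤ√10, a = b * q + r ∧ φ r < φ b := by
  rintro ⟨φ, hφ⟩
  exact not_isPrincipalIdealRing (Algorithm.isPrincipalIdealRing hφ)

/-- … equivalently, the transfinite construction of `ℤ[√10]` does not exhaust it (although it passes the units, §3).
[cite: Samuel1971, §5 Remark (2) (p. 294) and §4 (p. 289)] -/
theorem not_forall_exists_mem_samuelSet : ¬∀ x : ℤ√10, ∃ α : Ordinal.{0}, x ∈ samuelSet (ℤ√10) α := fun h ↦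
  not_exists_algorithm ⟨samuelRank, samuelRank_isAlgorithm h⟩

end Literature.NumberTheory.QuadraticFields.ZSqrtTen
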